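import Literature.NumberTheory.Transcendental.LineODEModel
import Literature.NumberTheory.Transcendental.ArithPoly
import Literature.NumberTheory.Transcendental.NonVanishing
import HarnessLib

/-!
# Arithmetic of the word forms: degrees, sizes and denominators along words

Topic: `Literature/NumberTheory/Transcendental`. Plan item W4/S2b (second half) of the unit
`provefact-Literature.NumberTheory.Transcendental.H-b596640137`. Combining the one-step
bookkeeping of `ArithPoly.lean` with the word recursion of `LineJetForms.lean`:

* `ArithPoly.word_bounds` — for derivations `D_m = D_{Q^{(m)}}` over a field `K` with
  `deg Q ≤ 2`, `‖Q‖_σ ≤ q`, `d^{e_Q} Q` integral, and `F` with `deg F ≤ N`, `‖F‖_σ ≤ B`,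
  `d^e F` integral: along any word `ω` of length `k`,
  `deg W_ω F ≤ N + 2k`, `‖W_ω F‖_σ ≤ (N + 2k)^k q^k B`, `d^{e + k e_Q} W_ω F` integral;
* `ArithPoly.word_eval_bounds` — consequently the VALUE `(W_ω F)(g)` at a point with `d·gᵢ`
  integral and conjugates `≤ M` satisfies `|σ((W_ω F)(g))| ≤ (N+2k)^k q^k B M^{N+2k}` and
  `d^{e + k e_Q + N + 2k} (W_ω F)(g) ∈ 𝓞` — the entries of the Siegel system and the algebraic
  numbers of the Liouville step (Baker–Wüstholz 2007, §6.8, (6.18)–(6.19));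
* `GaGmE.Std.homogMonomialᵣ` — the homogenised monomials `X_{J₀}^{D-|ν|} X^{affIdx ν}` over any
  ring (base-change invariant, `map_homogMonomialᵣ`), with `homog D (monomial ν a) = a · homogMonomial`
  (`homog_monomial`) and `homog D Q = ∑_ν coeff_ν Q · homogMonomial D ν` (`homog_eq_sum`): the
  auxiliary form is a `K`-linear combination of base-change-invariant forms, as `wordForm_eq_map`
  (`LineODEModel.lean`) requires.

## References

* A. Baker, G. Wüstholz, *Logarithmic Forms and Diophantine Geometry*, CUP 2007, §6.8.
-/

noncomputable section

open MvPolynomial Finset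
open Literature.NumberTheory.Transcendental.Chudnovsky
open scoped PeriodPair

namespace Literature.NumberTheory.Transcendental

/-! ### Word bounds -/

namespace ArithPoly

variable {K : Type*} [Field K] {ι : Type*} [Fintype ι]

omit [Fintype ι] in
/-- Changing the denominator to a multiple. [folklore] -/
theorem IsDenInt.of_dvd {d d' : ℤ} (h : d ∣ d') {e : ℕ} {F : MvPolynomial ι K} (hF : IsDenInt d e F) :
    IsDenInt d' e F := fun μ => by
  obtain ⟨c, rfl⟩ := h
  have : ((d * c : ℤ) : K) ^ e * MvPolynomial.coeff μ F = (c : K) ^ e * ((d : K) ^ e * MvPolynomial.coeff μ F) := by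
    push_cast; ring
  rw [this]
  exact ((isIntegral_intCast (B := K) c).pow _).mul (hF.coeff μ)

/-- **Bounds along words.** See the module docstring. [cite: BakerWustholz2007, §6.8 ((6.18)–(6.19))] -/
theorem word_bounds (σ : K →+* ℂ) {dd : ℕ} {Q : Fin dd → ι → MvPolynomial ι K} {q : ℝ} (hq0 : 0 ≤ q)
    (hq : ∀ m i, wnorm (embSeminorm σ) (Q m i) ≤ q) (hQ : ∀ m i, (Q m i).totalDegree ≤ 2)
    {d : ℤ} {eQ : ℕ} (hdQ : ∀ m i, IsDenInt d eQ (Q m i))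
    {F : MvPolynomial ι K} {N e : ℕ} {B : ℝ} (hN : F.totalDegree ≤ N)
    (hB : wnorm (embSeminorm σ) F ≤ B) (hF : IsDenInt d e F) :
    ∀ {k : ℕ} (ω : Fin k → Fin dd),
      (PolyODE.wordApp (fun m => (mkDerivation K (Q m)).toLinearMap) ω F).totalDegree ≤ N + 2 * k ∧
      wnorm (embSeminorm σ) (PolyODE.wordApp (fun m => (mkDerivation K (Q m)).toLinearMap) ω F) ≤
        (N + 2 * k : ℝ) ^ k * q ^ k * B ∧
      IsDenInt d (e + k * eQ) (PolyODE.wordApp (fun m => (mkDerivation K (Q m)).toLinearMap) ω F)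
  | 0, ω => by simpa using ⟨hN, hB, hF⟩
  | k + 1, ω => by
    obtain ⟨hdeg, hnorm, hden⟩ := word_bounds σ hq0 hq hQ hdQ hN hB hF (Fin.tail ω)
    have hB0 : 0 ≤ B := (wnorm_nonneg _ _).trans hB
    rw [PolyODE.wordApp_succ]
    change (mkDerivation K (Q (ω 0)) _).totalDegree ≤ _ ∧
      wnorm (embSeminorm σ) (mkDerivation K (Q (ω 0)) _) ≤ _ ∧ IsDenInt d _ (mkDerivation K (Q (ω 0)) _)
    refine ⟨?_, ?_, ?_⟩
    · refine (totalDegree_mkDerivation_le (hQ (ω 0)) _).trans ?_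
      omega
    · refine (wnorm_mkDerivation_le (embSeminorm σ) (by simp) hq0 (hq (ω 0)) hdeg).trans ?_
      have h1 : ((N + 2 * k : ℕ) : ℝ) * q * ((N + 2 * k : ℝ) ^ k * q ^ k * B) =
          (N + 2 * k : ℝ) ^ (k + 1) * q ^ (k + 1) * B := by push_cast; ring
      push_cast at h1 ⊢
      rw [show ((N : ℝ) + 2 * (k : ℝ)) * q * wnorm (embSeminorm σ)
          (PolyODE.wordApp (fun m => (mkDerivation K (Q m)).toLinearMap) (Fin.tail ω) F) ≤
          ((N : ℝ) + 2 * ((k : ℝ) + 1)) ^ (k + 1) * q ^ (k + 1) * B ↔ True from ?_]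
      · trivial
      · simp only [iff_true]
        calc ((N : ℝ) + 2 * k) * q * wnorm (embSeminorm σ) _
            ≤ ((N : ℝ) + 2 * k) * q * (((N : ℝ) + 2 * k) ^ k * q ^ k * B) :=
              mul_le_mul_of_nonneg_left hnorm (mul_nonneg (by positivity) hq0)
          _ = ((N : ℝ) + 2 * k) ^ (k + 1) * q ^ (k + 1) * B := by ring
          _ ≤ ((N : ℝ) + 2 * ((k : ℝ) + 1)) ^ (k + 1) * q ^ (k + 1) * B := by
              gcongr
              linarith
    · have := IsDenInt.mkDerivation (hdQ (ω 0)) hden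
      rw [show e + (k + 1) * eQ = e + k * eQ + eQ by ring]
      exact this

/-- **Values along words.** With `d·gᵢ` integral and `|σ gᵢ| ≤ M` (`M ≥ 1`):
`|σ((W_ω F)(g))| ≤ (N+2k)^k q^k B · M^{N+2k}` and `d^{e + k e_Q + (N + 2k)} (W_ω F)(g)` is an
algebraic integer. [cite: BakerWustholz2007, §6.8 ((6.18)–(6.19))] -/
theorem word_eval_bounds (σ : K →+* ℂ) {dd : ℕ} {Q : Fin dd → ι → MvPolynomial ι K} {q : ℝ}
    (hq0 : 0 ≤ q) (hq : ∀ m i, wnorm (embSeminorm σ) (Q m i) ≤ q) (hQ : ∀ m i, (Q m i).totalDegree ≤ 2)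
    {d : ℤ} {eQ : ℕ} (hdQ : ∀ m i, IsDenInt d eQ (Q m i))
    {F : MvPolynomial ι K} {N e : ℕ} {B : ℝ} (hN : F.totalDegree ≤ N)
    (hB : wnorm (embSeminorm σ) F ≤ B) (hF : IsDenInt d e F)
    {g : ι → K} (hg : ∀ i, IsIntegral ℤ ((d : K) * g i)) {M : ℝ} (hM : 1 ≤ M)
    (hgM : ∀ i, ‖σ (g i)‖ ≤ M) {k : ℕ} (ω : Fin k → Fin dd) :
    ‖σ (eval g (PolyODE.wordApp (fun m => (mkDerivation K (Q m)).toLinearMap) ω F))‖ ≤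
        (N + 2 * k : ℝ) ^ k * q ^ k * B * M ^ (N + 2 * k) ∧
      IsIntegral ℤ ((d : K) ^ (e + k * eQ + (N + 2 * k)) *
        eval g (PolyODE.wordApp (fun m => (mkDerivation K (Q m)).toLinearMap) ω F)) := by
  obtain ⟨hdeg, hnorm, hden⟩ := word_bounds σ hq0 hq hQ hdQ hN hB hF ω
  refine ⟨?_, hden.isIntegral_eval hdeg hg⟩
  refine (norm_embedding_eval_le σ _ g hM hgM).trans ?_
  have hB0 : 0 ≤ (N + 2 * k : ℝ) ^ k * q ^ k * B :=
    le_trans (wnorm_nonneg _ _) hnorm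
  exact mul_le_mul hnorm (pow_le_pow_right₀ hM hdeg) (by positivity) hB0

end ArithPoly

/-! ### Homogenised monomials -/

namespace GaGmE

namespace Std

variable {β γ δ : Type} [Fintype β] [Fintype γ] [Fintype δ] [DecidableEq γ]

section

variable {R S : Type*} [CommSemiring R] [CommSemiring S]

/-- The homogenised monomial `X_{J₀}^{D-|ν|} · X^{affIdx ν}` of degree `D` (for `|ν| ≤ D`),
over any coefficient ring. [folklore] -/
def homogMonomialᵣ (D : ℕ) (ν : β ⊕ (γ ⊕ δ) →₀ ℕ) : MvPolynomial (Option β × ThetaIdx γ δ) R :=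
  X (baseIdx (genericChart (γ := γ))) ^ (D - ν.degree) * monomial (ν.mapDomain affIdx) 1

omit [Fintype β] [Fintype γ] [Fintype δ] in
/-- The homogenised monomials are base-change invariant. [folklore] -/
theorem map_homogMonomialᵣ (f : R →+* S) (D : ℕ) (ν : β ⊕ (γ ⊕ δ) →₀ ℕ) :
    map f (homogMonomialᵣ (R := R) D ν) = homogMonomialᵣ D ν := by
  simp [homogMonomialᵣ, map_monomial]

end

omit [Fintype β] [Fintype γ] [Fintype δ] in
/-- **Homogenisation of a monomial**: `homog D (monomial ν a) = a · X_{J₀}^{D-|ν|} X^{affIdx ν}`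
for `|ν| ≤ D`. [folklore] -/
theorem homog_monomial {D : ℕ} {ν : β ⊕ (γ ⊕ δ) →₀ ℕ} (hν : ν.degree ≤ D) (a : ℂ) :
    homog D (monomial ν a) = C a * homogMonomialᵣ D ν := by
  unfold homog homogMonomialᵣ
  rw [rename_monomial]
  have hdeg : (Finsupp.mapDomain affIdx ν).degree = ν.degree := Finsupp.degree_mapDomain _ _
  have hmem : (monomial (Finsupp.mapDomain affIdx ν) a : MvPolynomial (Option β × ThetaIdx γ δ) ℂ) ∈
      homogeneousSubmodule (Option β × ThetaIdx γ δ) ℂ ν.degree :=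
    isHomogeneous_monomial _ hdeg
  simp only [homogeneousComponent_of_mem hmem, mul_ite, mul_zero]
  rw [Finset.sum_ite_eq' (Finset.range (D + 1)) ν.degree, if_pos (Finset.mem_range.mpr (Nat.lt_succ_of_le hν))]
  rw [show (monomial (Finsupp.mapDomain affIdx ν)) a =
      C a * (monomial (Finsupp.mapDomain affIdx ν) 1 : MvPolynomial (Option β × ThetaIdx γ δ) ℂ) by
    rw [C_mul_monomial, mul_one]]
  ring

omit [Fintype β] [Fintype γ] [Fintype δ] in
/-- `homog D` is additive. [folklore] -/
theorem homog_add (D : ℕ) (Q₁ Q₂ : MvPolynomial (β ⊕ (γ ⊕ δ)) ℂ) :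
    homog D (Q₁ + Q₂) = homog D Q₁ + homog D Q₂ := by
  simp only [homog, map_add, mul_add, Finset.sum_add_distrib]

omit [Fintype β] [Fintype γ] [Fintype δ] in
/-- `homog D 0 = 0`. [folklore] -/
theorem homog_zero (D : ℕ) : homog (β := β) (γ := γ) (δ := δ) D 0 = 0 := by
  simp [homog]

omit [Fintype β] [Fintype γ] [Fintype δ] in
/-- `homog D` over finite sums. [folklore] -/
theorem homog_sum {α : Type*} (D : ℕ) (s : Finset α) (Q : α → MvPolynomial (β ⊕ (γ ⊕ δ)) ℂ) :
    homog D (∑ a ∈ s, Q a) = ∑ a ∈ s, homog D (Q a) := by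
  classical
  induction s using Finset.induction_on with
  | empty => simp [homog_zero]
  | insert a s ha ih => rw [Finset.sum_insert ha, Finset.sum_insert ha, homog_add, ih]

omit [Fintype β] [Fintype γ] [Fintype δ] in
/-- **The auxiliary form as a combination of homogenised monomials**:
`homog D Q = ∑_{ν ∈ supp Q} coeff_ν Q · homogMonomial D ν` for `deg Q ≤ D`. [folklore] -/
theorem homog_eq_sum {D : ℕ} {Q : MvPolynomial (β ⊕ (γ ⊕ δ)) ℂ} (hQ : Q.totalDegree ≤ D) :
    homog D Q = ∑ ν ∈ Q.support, C (coeff ν Q) * homogMonomialᵣ D ν := by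
  conv_lhs => rw [Q.as_sum]
  rw [homog_sum]
  refine Finset.sum_congr rfl fun ν hν => homog_monomial ?_ _
  have := le_totalDegree hν
  rw [Finsupp.degree]
  simpa [Finsupp.sum] using this.trans hQ

end Std

end GaGmE

end Literature.NumberTheory.Transcendental

end
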